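import Mathlib
import HarnessLib
import Summits.Ventures.LatticeQCDFlow.Scoring.UStatisticCLT
import Summits.Ventures.LatticeQCDFlow.Scoring.UStatisticVarianceEstimator
import Summits.Ventures.LatticeQCDFlow.Scoring.SelfNormalisedReweightingStudentisedCLT

/-!
# The STUDENTISED central limit theorem for an order-2 U-statistic: with Sen's estimator `V̂ₙ`
# of the projection variance, `√n (Uₙ − μ_F) / (2√V̂ₙ) ⇒ N(0, 1)` — Hoeffding's CLT with its
# moment input estimated from the same data, so `Uₙ ± 2z√(V̂ₙ/n)` has asymptotically exact coverage

HONEST FRAMING: exact (Metropolis-corrected) sampling algorithms for lattice gauge theory;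
figures of merit are autocorrelation/cost numbers at stated couplings and volumes; no
continuum-physics claim.

Venture `LatticeQCDFlow` (cell pub-lqcd), topic `Scoring`; FANOUT row 4 (`s0-u1-b`, rung S0-B).
Sequel of `Scoring/UStatisticCLT` (`√n (Uₙ − μ_F) ⇒ 2Y`, `Y ∼ N(0, ζ₁)`) and
`Scoring/UStatisticVarianceEstimator` (Sen's `V̂ₙ = (1/n)Σᵢ(Ĥᵢ − Uₙ)² → ζ₁` in probability),
both imported: for a NON-DEGENERATE kernel (`ζ₁ > 0`) Slutsky's theorem
(`TendstoInDistribution.continuous_comp_prodMk_of_tendstoInMeasure_const` with the continuous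
`g(u, v) = u/(2√(max(v, ζ₁/2)))`) gives `g(√n (Uₙ − μ_F), V̂ₙ) ⇒ 2√ζ₁Y₁/(2√ζ₁) = Y₁` for a
standard normal `Y₁`, and the printed studentised statistic `√n (Uₙ − μ_F)/(2√V̂ₙ)` agrees with
`g(…)` on the event `{V̂ₙ > ζ₁/2}`, whose complement has probability `→ 0` — so their difference
tends to `0` in probability (`tendstoInMeasure_sub_zero_of_eqOn`, a two-line device recorded
here for reuse) and `tendstoInDistribution_of_tendstoInMeasure_sub` transfers the limit.
Printed counterpart NAMED ONLY (nothing cited as a fact): Arvesen, Ann. Math. Statist. 40 (1969)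
2076–2100, Thm 9 (asymptotic normality of the jackknifed U-statistic studentised by the
jackknife variance); Serfling (1980) §5.7.  NEW WORK of the cell (our formalisation); no
definition is introduced.  The application to the printed acceptance ratio (kernel
`min(w, w′) − (acc/2)(w + w′)` with `acc` replaced by the printed `Rₙ`) is the next file.

## Content (`ν` a law on `X`; stream `x : ℕ → Ω → X` independent with laws `ν`;
## `Uₙ`, `Ĥᵢ`, `V̂ₙ` as in `Scoring/UStatisticVarianceEstimator`; `μ_F = ∫ F d(ν⊗ν)`;
## `ζ₁ = ∫ h² dν − μ_F²`)

* `tendstoInMeasure_sub_zero_of_eqOn` — two statistics that agree on `{V̂ₙ > ζ/2}` with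
  `V̂ₙ → ζ > 0` in probability differ by `→ 0` in probability;
* `measurable_studentisedUStat` — measurability of the printed statistic;
* **`ustat₂_studentised_clt`** — THE THEOREM: `ζ₁ > 0`, `Y₁ ∼ N(0, 1)` ⇒
  `√n (Uₙ − μ_F)/(2√V̂ₙ) ⇒ Y₁` in distribution.

NOT CLAIMED: the degenerate case `ζ₁ = 0`; a Berry–Esseen or Edgeworth refinement; the `t`-type
finite-sample calibration; any number of ours re-scored.
-/

noncomputable section

namespace Summit.Ventures.LatticeQCDFlow.Scoring.CardConsistency

open MeasureTheory ProbabilityTheory Finset Real Filter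
open scoped Topology Function

/-! ## §1 A device: agreement on a high-probability event -/

section Device

variable {Ω : Type*} [MeasurableSpace Ω] {P : Measure Ω}

/-- **Agreement on a high-probability event.**  If `Vₙ → ζ > 0` in probability and two real
statistics `Tₙ`, `Sₙ` coincide whenever `Vₙ > ζ/2`, then `Tₙ − Sₙ → 0` in probability
(`{Tₙ ≠ Sₙ} ⊆ {|Vₙ − ζ| ≥ ζ/2}`). [ours] -/
theorem tendstoInMeasure_sub_zero_of_eqOn {T S V : ℕ → Ω → ℝ} {ζ : ℝ} (hζ : 0 < ζ)
    (hV : TendstoInMeasure P V atTop (fun _ => ζ))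
    (heq : ∀ n ω, ζ / 2 < V n ω → T n ω = S n ω) :
    TendstoInMeasure P (T - S) atTop 0 := by
  rw [tendstoInMeasure_iff_norm] at hV ⊢
  intro ε hε
  refine tendsto_of_tendsto_of_tendsto_of_le_of_le' tendsto_const_nhds (hV (ζ / 2) (half_pos hζ))
    (Eventually.of_forall fun n => zero_le) (Eventually.of_forall fun n => ?_)
  refine measure_mono fun ω hω => ?_
  simp only [Set.mem_setOf_eq, Pi.sub_apply, Pi.zero_apply, sub_zero] at hω ⊢
  by_contra hlt
  have hVω : ζ / 2 < V n ω := by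
    rw [not_le, Real.norm_eq_abs, abs_lt] at hlt
    linarith [hlt.1]
  rw [heq n ω hVω, sub_self, norm_zero] at hω
  exact absurd hω (not_le.2 hε)

end Device

/-! ## §2 The studentised CLT -/

section Studentised

variable {Ω : Type*} [MeasurableSpace Ω] {P : Measure Ω} [IsProbabilityMeasure P]
variable {Ω' : Type*} [MeasurableSpace Ω'] {P' : Measure Ω'} [IsProbabilityMeasure P']
variable {X : Type*} [MeasurableSpace X] {ν : Measure X} {x : ℕ → Ω → X} {Y₁ : Ω' → ℝ}

omit [IsProbabilityMeasure P] in
/-- The printed studentised U-statistic `√n (Uₙ − m)/(2√V̂ₙ)` is measurable. [ours] -/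
theorem measurable_studentisedUStat (hxm : ∀ i, Measurable (x i)) {F : X → X → ℝ}
    (hFm : Measurable fun z : X × X => F z.1 z.2) (m : ℝ) (n : ℕ) :
    Measurable fun ω => Real.sqrt n *
        ((∑ z ∈ (univ : Finset (Fin n)).offDiag, F (x z.1 ω) (x z.2 ω)) / (n * (n - 1) : ℝ) - m)
      / (2 * Real.sqrt ((∑ i : Fin n, ((∑ j ∈ univ.erase i, F (x i ω) (x j ω)) / ((n : ℝ) - 1)
          - (∑ z ∈ (univ : Finset (Fin n)).offDiag, F (x z.1 ω) (x z.2 ω)) / (n * (n - 1) : ℝ))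
            ^ 2) / (n : ℝ))) :=
  (((measurable_ustat₂_iid (x := fun (i : Fin n) ω => x i ω) (fun _ => hxm _) hFm).sub_const
    m).const_mul _).div ((measurable_senVariance hxm hFm n).sqrt.const_mul _)

/-- **THE STUDENTISED CLT FOR AN ORDER-2 U-STATISTIC.**  For an independent stream `xᵢ` with
common law `ν`, a symmetric measurable kernel `F ∈ L²(ν ⊗ ν)` with NON-DEGENERATE projection
(`ζ₁ = ∫ (∫ F(a, b) dν(b))² dν(a) − (∫ F d(ν ⊗ ν))² > 0`), and any standard normal variable `Y₁`:
with `Uₙ = Σ_{i≠j<n} F(xᵢ, xⱼ)/(n(n−1))`, row means `Ĥᵢ = Σ_{j≠i} F(xᵢ, xⱼ)/(n−1)` and Sen's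
`V̂ₙ = (1/n)Σᵢ (Ĥᵢ − Uₙ)²`, the studentised statistic satisfies
`√n (Uₙ − ∫ F d(ν ⊗ ν)) / (2√V̂ₙ) ⇒ Y₁` in distribution. [ours] -/
theorem ustat₂_studentised_clt (hxm : ∀ i, Measurable (x i)) (hind : iIndepFun x P)
    (hlaw : ∀ i, Measure.map (x i) P = ν) {F : X → X → ℝ}
    (hFm : Measurable fun z : X × X => F z.1 z.2) (hF : ∀ a b, F a b = F b a)
    (hF2 : MemLp (fun z : X × X => F z.1 z.2) 2 (ν.prod ν))
    (hζ : 0 < (∫ a, (∫ b, F a b ∂ν) ^ 2 ∂ν) - (∫ z, F z.1 z.2 ∂(ν.prod ν)) ^ 2)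
    (hY1 : HasLaw Y₁ (gaussianReal 0 1) P') :
    TendstoInDistribution (fun (n : ℕ) ω => Real.sqrt n *
        ((∑ z ∈ (univ : Finset (Fin n)).offDiag, F (x z.1 ω) (x z.2 ω)) / (n * (n - 1) : ℝ)
          - ∫ z, F z.1 z.2 ∂(ν.prod ν))
        / (2 * Real.sqrt ((∑ i : Fin n, ((∑ j ∈ univ.erase i, F (x i ω) (x j ω)) / ((n : ℝ) - 1)
            - (∑ z ∈ (univ : Finset (Fin n)).offDiag, F (x z.1 ω) (x z.2 ω)) / (n * (n - 1) : ℝ))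
              ^ 2) / (n : ℝ))))
      atTop Y₁ (fun _ => P) P' := by
  -- the CLT with limit `2·(√ζ₁·Y₁)`, `√ζ₁·Y₁ ∼ N(0, ζ₁)`
  have hYg := hasLaw_sqrt_mul_gaussian hY1 hζ.le
  have hclt := ustat₂_clt (P' := P') hxm hind hlaw hFm hF hF2 hYg
  -- Sen's estimator `V̂ₙ → ζ₁` in probability
  have hV := senVariance_tendstoInMeasure hxm hind hlaw hFm hF hF2
  -- abbreviate the two constants
  obtain ⟨m, hm⟩ : ∃ m : ℝ, m = ∫ z, F z.1 z.2 ∂(ν.prod ν) := ⟨_, rfl⟩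
  obtain ⟨ζ, hζdef⟩ : ∃ ζ : ℝ, ζ = (∫ a, (∫ b, F a b ∂ν) ^ 2 ∂ν) - m ^ 2 := ⟨_, rfl⟩
  rw [← hm] at hζ hclt hV ⊢
  rw [← hζdef] at hζ hclt hV
  have hVm := fun n => measurable_senVariance (x := x) hxm hFm n
  -- Slutsky with `g(u, v) = u / (2√(max(v, ζ/2)))`
  have hden : ∀ v : ℝ, 2 * Real.sqrt (max v (ζ / 2)) ≠ 0 := fun v =>
    mul_ne_zero two_ne_zero (Real.sqrt_pos.2 (lt_max_of_lt_right (half_pos hζ))).ne'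
  have hgc : Continuous fun z : ℝ × ℝ => z.1 / (2 * Real.sqrt (max z.2 (ζ / 2))) :=
    continuous_fst.div (continuous_const.mul (continuous_snd.max continuous_const).sqrt)
      fun z => hden z.2
  have hsl := hclt.continuous_comp_prodMk_of_tendstoInMeasure_const hgc hV
    (fun n => (hVm n).aemeasurable)
  have elim : (fun ω' => 2 * (Real.sqrt ζ * Y₁ ω') / (2 * Real.sqrt (max ζ (ζ / 2)))) = Y₁ := by
    funext ω'
    rw [max_eq_left (by linarith), mul_div_mul_left _ _ (two_ne_zero' ℝ), mul_comm,
      mul_div_assoc, div_self (Real.sqrt_pos.2 hζ).ne', mul_one]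
  rw [elim] at hsl
  -- the printed statistic agrees with the Slutsky statistic on `{V̂ₙ > ζ/2}`
  refine tendstoInDistribution_of_tendstoInMeasure_sub (μ'' := P) (μ' := P') _ Y₁ hsl ?_
    (fun n => (measurable_studentisedUStat hxm hFm m n).aemeasurable)
  refine tendstoInMeasure_sub_zero_of_eqOn hζ hV fun n ω hVω => ?_
  dsimp only
  rw [max_eq_left hVω.le]

end Studentised

end Summit.Ventures.LatticeQCDFlow.Scoring.CardConsistency

end
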